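import Summits.QuantumFields.BalabanUV.Beta.MultiscaleCoercive
import Summits.QuantumFields.BalabanUV.Beta.CovariantBoxPoincareGauge

/-!
# Beta / MultiscaleCoerciveGauge — THE MULTI-REGION ASSEMBLY FOR THE |A|-HALF ROUTE: part (C)'s level-count-free sum over
# pairwise distinct charted cells, with each cell's inequality taken from part (E) (`CovariantBoxPoincareGauge`: a (3.35)-literal
# small gauge per cell + one gauge-comparison rotation) instead of part (B)'s tree-gauge defect; in print's normalisation
# `(1 − θ)·min(c²/(4ν), a/4)·Σ_k n_k⁻²·‖f‖²_{cell k} ≤ ⟨f, levelOp f⟩` with per-cell loss `4P_kνε_k² + 4δ_k² ≤ θ` — for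
# `ε_k = C/n_k`, `δ_k = νC` a constant depending on `ν`, `c`, `a` and `θ ≤ 8ν²C²` ONLY
# (unit `b2b-balaban-beta-d4-p2`, GEN 7, MODEL crew; claim «MULTISCALE-POINCARE-MODEL» journal l.16779∕l.17528, part (F); over (C)
# `MultiscaleCoercive` p226432 and (E) `CovariantBoxPoincareGauge`)

HONEST FRAMING: discharging `BetaPertH` makes Bałaban's UV stability UNCONDITIONAL — NOT the continuum limit, NOT the
Clay problem.  HONEST DEPENDENCY (verbatim): «continuum YM on T⁴ ⇐ BetaPertH ∧ nine spine estimates (0/9 proved);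
BetaPertH ⇐ (D1) ∧ (D4) ∧ CAP+tail; G-an2-4 gates asym, D1 and NE2/3/4.»  THIS MODULE DISCHARGES NOTHING of `BetaPertH`,
asserts NOTHING printed and cites nothing as a fact (ABSOLUTE RULE): [folklore] bookkeeping about the pv21 component MODEL
(`B9Thm37GlueTorusCovLevels.levelOp` with GENERAL data; cells, charts, gauges, rotations, sizes as DATA).  WHAT IT IS FOR
(row D4, O.2 item (v)): the COERCIVITY half of [B9] = `Balaban1985BackgroundPropagators` Thm 3.1's local prefactor `(L^jη)²` for a
general background from the |A|-half of (3.35) p. 396 alone, level-count-free; the tree-transport route of (B)∕(C) needs both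
halves of (3.35) for uniformity (d4-p3 XREAD C-d4p3-26 INFO-3).  NOT the decay half; nothing of Bałaban's own `U_k`, `Ū^l`.
No class change on row D4 (critical-path width 0; D4 DISCHARGE NO DATE); NOT BetaPertH, NOT continuum, NOT Clay, NOT summit progress.

CONTENT (kernel, 0 sorry).  §1 the generic assembly **`multiscale_coercive_of_cells`** (any per-cell inequalities
`L_k ≤ E_k + a_{l_k}·Σ_a G f(β_k, a)²` summed against `qform_levelOp` under `hbond`∕`hcell`) — the common spine of (C) and (F).
§2 **`cell_bound_gauge`** (budget `t`: `t·4P/c² ≤ 1`, `t·4/n^ν ≤ a_l w²` ⟹ `t(1 − 4Pνε² − 4δ²)‖f‖²_cell ≤ E_cell + a_lΣG²`).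
§3 ENDs **`multiscale_coercive_gauge`** and **`multiscale_coercive_gauge_scaled`** (`κ′ = min(c²/(4ν), a_min/4)`).
-/

namespace Summit.QuantumFields.BalabanUV.Beta.MultiscaleCoerciveGauge

open Finset Function
open Summit.QuantumFields.BalabanUV.Beta.BoxPoincare
open Summit.QuantumFields.BalabanUV.Beta.CovariantBoxPoincare
open Summit.QuantumFields.BalabanUV.Beta.CovariantBoxPoincareGauge
open Summit.QuantumFields.BalabanUV.Beta.MultiscaleCoercive
open Literature.MathematicalPhysics.QuantumFieldTheory.Balaban1983to89.B9Thm37Glue (covD covD_apply)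
open Literature.MathematicalPhysics.QuantumFieldTheory.Balaban1983to89.B9Thm37GlueTorusCovComp (gMean gMean_apply)
open Literature.MathematicalPhysics.QuantumFieldTheory.Balaban1983to89.B9Thm37GlueTorusCovLevels (levelOp qform_levelOp)

noncomputable section

variable {St Bd B Cp J K : Type} [Fintype St] [DecidableEq St] [DecidableEq B] [Fintype Cp] {ν : ℕ}

/-! ## §1 The generic assembly from per-cell inequalities -/

section Generic

variable [Fintype Bd] [Fintype B] [Fintype J] [Fintype K] (src tgt : Bd → St) (c : Bd → ℝ)
  (Rm : Bd → Cp → Cp → ℝ) (blk : J → St → B) (W : J → St → ℝ) (T : J → St → Cp → Cp → ℝ) (a : J → ℝ)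
  (n : K → ℕ) (lvl : K → J) (lab : K → B)
  (e : (k : K) → (v : Box ν (n k)) → (i : Fin ν) → ((v i : ℕ) + 1 < n k) → Bd)

/-- **The generic assembly.**  If every cell's quantity `L_k` is paid by the cell's own covariant energy plus its own averaging
term, and the cells are pairwise distinct with pairwise distinct in-box bonds (`hbond`∕`hcell`), then `Σ_k L_k ≤ ⟨f, levelOp f⟩`.
[cite: Balaban1985BackgroundPropagators, (3.24) p.394] -/
theorem multiscale_coercive_of_cells (f : St × Cp → ℝ) (L : K → ℝ)
    (hcells : ∀ k, L k ≤
      ∑ v : Box ν (n k), ∑ i : Fin ν,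
          (if hv : (v i : ℕ) + 1 < n k then ∑ i', covD src tgt c Rm f (e k v i hv, i') ^ 2 else 0) +
        a (lvl k) * ∑ a', gMean (blk (lvl k)) (W (lvl k)) (T (lvl k)) f (lab k, a') ^ 2)
    (hbond : ∀ F : Bd → ℝ, (∀ b, 0 ≤ F b) →
      ∑ k, ∑ v : Box ν (n k), ∑ i : Fin ν, (if hv : (v i : ℕ) + 1 < n k then F (e k v i hv) else 0) ≤ ∑ b, F b)
    (hcell : ∀ A : J → B → ℝ, (∀ j β, 0 ≤ A j β) → ∑ k, a (lvl k) * A (lvl k) (lab k) ≤ ∑ j, a j * ∑ β, A j β) :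
    ∑ k, L k ≤ ∑ p, f p * levelOp src tgt c Rm blk W T a f p := by
  have hEsum := hbond (fun b => ∑ i', covD src tgt c Rm f (b, i') ^ 2) fun b => sum_nonneg fun _ _ => sq_nonneg _
  have hGsum := hcell (fun j β => ∑ a', gMean (blk j) (W j) (T j) f (β, a') ^ 2)
    fun j β => sum_nonneg fun _ _ => sq_nonneg _
  rw [qform_levelOp]
  calc ∑ k, L k
      ≤ ∑ k, (∑ v : Box ν (n k), ∑ i : Fin ν,
            (if hv : (v i : ℕ) + 1 < n k then ∑ i', covD src tgt c Rm f (e k v i hv, i') ^ 2 else 0) +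
          a (lvl k) * ∑ a', gMean (blk (lvl k)) (W (lvl k)) (T (lvl k)) f (lab k, a') ^ 2) :=
        Finset.sum_le_sum fun k _ => hcells k
    _ ≤ ∑ b, ∑ i', covD src tgt c Rm f (b, i') ^ 2 + ∑ j, a j * ∑ β, ∑ a', gMean (blk j) (W j) (T j) f (β, a') ^ 2 := by
        rw [Finset.sum_add_distrib]
        exact add_le_add hEsum hGsum
    _ = ∑ b, covD src tgt c Rm f b * covD src tgt c Rm f b +
          ∑ j, a j * ∑ q, gMean (blk j) (W j) (T j) f q * gMean (blk j) (W j) (T j) f q := by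
        congr 1
        · rw [Fintype.sum_prod_type]
          exact Finset.sum_congr rfl fun b _ => Finset.sum_congr rfl fun i _ => by ring
        · refine Finset.sum_congr rfl fun j _ => ?_
          rw [Fintype.sum_prod_type]
          congr 1
          exact Finset.sum_congr rfl fun β _ => Finset.sum_congr rfl fun a' _ => by ring

end Generic

/-! ## §2 The cell bound of the |A|-half route -/

section CellBound

variable [DecidableEq Cp] {src tgt : Bd → St} {n : ℕ}

/-- **THE CELL BOUND, |A|-HALF ROUTE.**  As `MultiscaleCoercive.cell_bound`, but the cell carries a small GAUGE `g` (gauged in-box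
bond variables `ε`-close to `1`) and a comparison rotation `O` (`‖g(x)T(x)ᵀ − O‖ ≤ δ`) instead of a tree-gauge defect; budget
`t ≥ 0` with `t·4P/c_min² ≤ 1`, `t·4/n^ν ≤ a_l w²`: `t·(1 − 4Pνε² − 4δ²)·Σ_v|f(φ v)|² ≤ E_cell + a_l·Σ_a G f(β,a)²`.
[cite: Balaban1985BackgroundPropagators, (3.24) p.394 + (3.35) p.396] -/
theorem cell_bound_gauge (blk : St → B) (W : St → ℝ) (T : St → Cp → Cp → ℝ) {al : ℝ}
    (φ : Box ν n → St) (β : B) {wt : ℝ} (hφinj : Injective φ) (hφblk : ∀ x, blk x = β ↔ ∃ v, φ v = x)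
    (hW : ∀ v, W (φ v) = wt) (e : (v : Box ν n) → (i : Fin ν) → ((v i : ℕ) + 1 < n) → Bd)
    (hsrc : ∀ v i hv, src (e v i hv) = φ v) (htgt : ∀ v i hv, tgt (e v i hv) = φ (succ v i hv))
    (c : Bd → ℝ) {cmin : ℝ} (hcmin : 0 < cmin) (hcb : ∀ v i hv, cmin ≤ |c (e v i hv)|)
    (Rm : Bd → Cp → Cp → ℝ) (hT : ∀ v i i', ∑ k, T (φ v) k i * T (φ v) k i' = if i = i' then (1 : ℝ) else 0)
    (g : Box ν n → Cp → Cp → ℝ) (O : Cp → Cp → ℝ)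
    (hg : ∀ v i i', ∑ k, g v k i * g v k i' = if i = i' then (1 : ℝ) else 0)
    (hO : ∀ i i', ∑ k, O k i * O k i' = if i = i' then (1 : ℝ) else 0) {ε δ : ℝ}
    (hgauge : ∀ v i hv (u : Cp → ℝ),
      ∑ a, (∑ j, (hol Rm g e v i hv a j - if a = j then 1 else 0) * u j) ^ 2 ≤ ε ^ 2 * ∑ j, u j ^ 2)
    (hcmp : ∀ v (u : Cp → ℝ), ∑ a, (∑ j, cmpD (fun v => T (φ v)) g O v a j * u j) ^ 2 ≤ δ ^ 2 * ∑ j, u j ^ 2)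
    {t : ℝ} (ht0 : 0 ≤ t) (ht1 : t * (4 * ((ν : ℝ) * n * ((n : ℝ) - 1)) / cmin ^ 2) ≤ 1)
    (ht2 : t * (4 / (n : ℝ) ^ ν) ≤ al * wt ^ 2) (f : St × Cp → ℝ) :
    t * (1 - 4 * ((ν : ℝ) * n * ((n : ℝ) - 1)) * ν * ε ^ 2 - 4 * δ ^ 2) * ∑ v : Box ν n, ∑ k, f (φ v, k) ^ 2 ≤
      ∑ v : Box ν n, ∑ i : Fin ν,
          (if hv : (v i : ℕ) + 1 < n then ∑ k, covD src tgt c Rm f (e v i hv, k) ^ 2 else 0) +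
        al * ∑ a, gMean blk W T f (β, a) ^ 2 := by
  set P : ℝ := (ν : ℝ) * n * ((n : ℝ) - 1) with hP
  set Sf : ℝ := ∑ v : Box ν n, ∑ k, f (φ v, k) ^ 2
  set E : ℝ := ∑ v : Box ν n, ∑ i : Fin ν,
    (if hv : (v i : ℕ) + 1 < n then ∑ k, covD src tgt c Rm f (e v i hv, k) ^ 2 else 0) with hE
  set M : ℝ := ∑ a, (∑ v : Box ν n, tf (fun v => T (φ v)) φ f v a) ^ 2 with hM
  have hEnn : 0 ≤ E :=
    sum_nonneg fun v _ => sum_nonneg fun i _ => by split_ifs <;> [exact sum_nonneg fun _ _ => sq_nonneg _; exact le_rfl]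
  have hMnn : 0 ≤ M := sum_nonneg fun _ _ => sq_nonneg _
  -- part (E)
  have hB := covariant_box_poincare_gauge φ e hsrc htgt c hcmin hcb Rm (fun v => T (φ v)) g O hT hg hO hgauge hcmp f
  -- the averaging term of the cell
  have hG : ∑ a, gMean blk W T f (β, a) ^ 2 = wt ^ 2 * M := by
    rw [hM, Finset.mul_sum]
    refine Finset.sum_congr rfl fun a _ => ?_
    rw [gMean_cell blk W T φ β hφinj hφblk hW f a, mul_pow]
  rw [hG]
  have hB' : t * ((1 - 4 * P * ν * ε ^ 2 - 4 * δ ^ 2) * Sf) ≤ t * (4 * P / cmin ^ 2 * E + 4 / (n : ℝ) ^ ν * M) :=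
    mul_le_mul_of_nonneg_left hB ht0
  calc t * (1 - 4 * P * ν * ε ^ 2 - 4 * δ ^ 2) * Sf = t * ((1 - 4 * P * ν * ε ^ 2 - 4 * δ ^ 2) * Sf) := by ring
    _ ≤ t * (4 * P / cmin ^ 2 * E + 4 / (n : ℝ) ^ ν * M) := hB'
    _ = (t * (4 * P / cmin ^ 2)) * E + (t * (4 / (n : ℝ) ^ ν)) * M := by ring
    _ ≤ 1 * E + (al * wt ^ 2) * M :=
        add_le_add (mul_le_mul_of_nonneg_right ht1 hEnn) (mul_le_mul_of_nonneg_right ht2 hMnn)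
    _ = E + al * (wt ^ 2 * M) := by ring

end CellBound

/-! ## §3 The ENDs of the |A|-half route -/

section Assembly

variable [Fintype Bd] [Fintype B] [DecidableEq Cp] [Fintype J] [Fintype K] (src tgt : Bd → St) (c : Bd → ℝ)
  (Rm : Bd → Cp → Cp → ℝ) (blk : J → St → B) (W : J → St → ℝ) (T : J → St → Cp → Cp → ℝ) (a : J → ℝ)
  -- the cells: side, level, block, weight, gauge size, comparison size, budget, chart, in-box bonds, gauge, rotation
  (n : K → ℕ) (lvl : K → J) (lab : K → B) (wt ε δ t : K → ℝ)
  (φ : (k : K) → Box ν (n k) → St)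
  (e : (k : K) → (v : Box ν (n k)) → (i : Fin ν) → ((v i : ℕ) + 1 < n k) → Bd)
  (g : (k : K) → Box ν (n k) → Cp → Cp → ℝ) (O : K → Cp → Cp → ℝ)

/-- **THE k-UNIFORM MULTISCALE LOCAL COERCIVITY, |A|-HALF ROUTE (MODEL).**  As `MultiscaleCoercive.multiscale_coercive` with each
cell's tree-gauge defect replaced by a small gauge `g_k` (`ε_k`) and a comparison rotation `O_k` (`δ_k`); budgets
`t_k·4P_k/c_min² ≤ 1`, `t_k·4/n_k^ν ≤ a_{l_k}w_k²`: `Σ_k t_k(1 − 4P_kνε_k² − 4δ_k²)·Σ_v|f(φ_k v)|² ≤ ⟨f, levelOp f⟩`.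
[cite: Balaban1985BackgroundPropagators, (3.24) p.394 + (3.35) p.396] -/
theorem multiscale_coercive_gauge
    (hT : ∀ j x i i', ∑ k, T j x k i * T j x k i' = if i = i' then (1 : ℝ) else 0) {cmin : ℝ} (hcmin : 0 < cmin)
    (hφinj : ∀ k, Injective (φ k)) (hφblk : ∀ k x, blk (lvl k) x = lab k ↔ ∃ v, φ k v = x)
    (hW : ∀ k v, W (lvl k) (φ k v) = wt k)
    (hsrc : ∀ k v i hv, src (e k v i hv) = φ k v) (htgt : ∀ k v i hv, tgt (e k v i hv) = φ k (succ v i hv))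
    (hcb : ∀ k v i hv, cmin ≤ |c (e k v i hv)|)
    (hg : ∀ k v i i', ∑ k', g k v k' i * g k v k' i' = if i = i' then (1 : ℝ) else 0)
    (hO : ∀ k i i', ∑ k', O k k' i * O k k' i' = if i = i' then (1 : ℝ) else 0)
    (hgauge : ∀ k v i hv (u : Cp → ℝ),
      ∑ a', (∑ j, (hol Rm (g k) (e k) v i hv a' j - if a' = j then 1 else 0) * u j) ^ 2 ≤ ε k ^ 2 * ∑ j, u j ^ 2)
    (hcmp : ∀ k v (u : Cp → ℝ),
      ∑ a', (∑ j, cmpD (fun v => T (lvl k) (φ k v)) (g k) (O k) v a' j * u j) ^ 2 ≤ δ k ^ 2 * ∑ j, u j ^ 2)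
    (ht0 : ∀ k, 0 ≤ t k) (ht1 : ∀ k, t k * (4 * ((ν : ℝ) * (n k) * ((n k : ℝ) - 1)) / cmin ^ 2) ≤ 1)
    (ht2 : ∀ k, t k * (4 / (n k : ℝ) ^ ν) ≤ a (lvl k) * wt k ^ 2)
    (hbond : ∀ F : Bd → ℝ, (∀ b, 0 ≤ F b) →
      ∑ k, ∑ v : Box ν (n k), ∑ i : Fin ν, (if hv : (v i : ℕ) + 1 < n k then F (e k v i hv) else 0) ≤ ∑ b, F b)
    (hcell : ∀ A : J → B → ℝ, (∀ j β, 0 ≤ A j β) → ∑ k, a (lvl k) * A (lvl k) (lab k) ≤ ∑ j, a j * ∑ β, A j β)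
    (f : St × Cp → ℝ) :
    ∑ k, t k * (1 - 4 * ((ν : ℝ) * (n k) * ((n k : ℝ) - 1)) * ν * ε k ^ 2 - 4 * δ k ^ 2) *
        ∑ v : Box ν (n k), ∑ i, f (φ k v, i) ^ 2 ≤
      ∑ p, f p * levelOp src tgt c Rm blk W T a f p :=
  multiscale_coercive_of_cells src tgt c Rm blk W T a n lvl lab e f _
    (fun k => cell_bound_gauge (blk (lvl k)) (W (lvl k)) (T (lvl k)) (φ k) (lab k) (hφinj k) (hφblk k) (hW k) (e k)
      (hsrc k) (htgt k) c hcmin (hcb k) Rm (fun v i i' => hT (lvl k) (φ k v) i i') (g k) (O k) (hg k) (hO k) (hgauge k)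
      (hcmp k) (ht0 k) (ht1 k) (ht2 k) f)
    hbond hcell

/-- **PRINT'S NORMALISATION, |A|-HALF ROUTE ⟹ A CONSTANT DEPENDING ON `ν, c, a, θ` ONLY.**  Cells with `1 ≤ n_k`, print-size
weights `a_{l_k}w_k²n_k^ν ≥ a_min/n_k²`, and per-cell loss `4P_kνε_k² + 4δ_k² ≤ θ` (for `ε_k = C/n_k`, `δ_k = νC`: `θ = 8ν²C²`):
with `κ′ = min(c_min²/(4ν), a_min/4)`, **`(1 − θ)·κ′·Σ_k n_k⁻²·Σ_v|f(φ_k v)|² ≤ ⟨f, levelOp f⟩`** — uniform in the number of levels and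
cells and in the cell sides. [cite: Balaban1985BackgroundPropagators, (3.24) p.394 + (3.35) p.396 + Thm 3.1 p.397] -/
theorem multiscale_coercive_gauge_scaled
    (hT : ∀ j x i i', ∑ k, T j x k i * T j x k i' = if i = i' then (1 : ℝ) else 0) {cmin : ℝ} (hcmin : 0 < cmin)
    (hφinj : ∀ k, Injective (φ k)) (hφblk : ∀ k x, blk (lvl k) x = lab k ↔ ∃ v, φ k v = x)
    (hW : ∀ k v, W (lvl k) (φ k v) = wt k)
    (hsrc : ∀ k v i hv, src (e k v i hv) = φ k v) (htgt : ∀ k v i hv, tgt (e k v i hv) = φ k (succ v i hv))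
    (hcb : ∀ k v i hv, cmin ≤ |c (e k v i hv)|)
    (hg : ∀ k v i i', ∑ k', g k v k' i * g k v k' i' = if i = i' then (1 : ℝ) else 0)
    (hO : ∀ k i i', ∑ k', O k k' i * O k k' i' = if i = i' then (1 : ℝ) else 0)
    (hgauge : ∀ k v i hv (u : Cp → ℝ),
      ∑ a', (∑ j, (hol Rm (g k) (e k) v i hv a' j - if a' = j then 1 else 0) * u j) ^ 2 ≤ ε k ^ 2 * ∑ j, u j ^ 2)
    (hcmp : ∀ k v (u : Cp → ℝ),
      ∑ a', (∑ j, cmpD (fun v => T (lvl k) (φ k v)) (g k) (O k) v a' j * u j) ^ 2 ≤ δ k ^ 2 * ∑ j, u j ^ 2)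
    (hbond : ∀ F : Bd → ℝ, (∀ b, 0 ≤ F b) →
      ∑ k, ∑ v : Box ν (n k), ∑ i : Fin ν, (if hv : (v i : ℕ) + 1 < n k then F (e k v i hv) else 0) ≤ ∑ b, F b)
    (hcell : ∀ A : J → B → ℝ, (∀ j β, 0 ≤ A j β) → ∑ k, a (lvl k) * A (lvl k) (lab k) ≤ ∑ j, a j * ∑ β, A j β)
    (hν : 1 ≤ ν) (hn : ∀ k, 1 ≤ n k) {amin : ℝ} (hamin : 0 ≤ amin)
    (hscale : ∀ k, amin / (n k : ℝ) ^ 2 ≤ a (lvl k) * wt k ^ 2 * (n k : ℝ) ^ ν) {θ : ℝ}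
    (hloss : ∀ k, 4 * ((ν : ℝ) * (n k) * ((n k : ℝ) - 1)) * ν * ε k ^ 2 + 4 * δ k ^ 2 ≤ θ) (f : St × Cp → ℝ) :
    (1 - θ) * min (cmin ^ 2 / (4 * ν)) (amin / 4) * ∑ k, ((n k : ℝ) ^ 2)⁻¹ * ∑ v : Box ν (n k), ∑ i, f (φ k v, i) ^ 2 ≤
      ∑ p, f p * levelOp src tgt c Rm blk W T a f p := by
  set κ : ℝ := min (cmin ^ 2 / (4 * ν)) (amin / 4) with hκ
  have hνr : (1 : ℝ) ≤ ν := by exact_mod_cast hν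
  have hκnn : 0 ≤ κ := le_min (by positivity) (by positivity)
  have ht0 : ∀ k, 0 ≤ κ * ((n k : ℝ) ^ 2)⁻¹ := fun k => mul_nonneg hκnn (inv_nonneg.mpr (sq_nonneg _))
  have ht1 : ∀ k, κ * ((n k : ℝ) ^ 2)⁻¹ * (4 * ((ν : ℝ) * (n k) * ((n k : ℝ) - 1)) / cmin ^ 2) ≤ 1 := by
    intro k
    have hnk : (1 : ℝ) ≤ n k := by exact_mod_cast hn k
    have hc2 : 0 < cmin ^ 2 := by positivity
    have hfac : 0 ≤ ((n k : ℝ) ^ 2)⁻¹ * (4 * ((ν : ℝ) * (n k) * ((n k : ℝ) - 1)) / cmin ^ 2) := by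
      have : (0 : ℝ) ≤ (n k : ℝ) - 1 := by linarith
      positivity
    calc κ * ((n k : ℝ) ^ 2)⁻¹ * (4 * ((ν : ℝ) * (n k) * ((n k : ℝ) - 1)) / cmin ^ 2)
        = κ * (((n k : ℝ) ^ 2)⁻¹ * (4 * ((ν : ℝ) * (n k) * ((n k : ℝ) - 1)) / cmin ^ 2)) := by ring
      _ ≤ cmin ^ 2 / (4 * ν) * (((n k : ℝ) ^ 2)⁻¹ * (4 * ((ν : ℝ) * (n k) * ((n k : ℝ) - 1)) / cmin ^ 2)) :=
          mul_le_mul_of_nonneg_right (min_le_left _ _) hfac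
      _ = ((n k : ℝ) - 1) / (n k) := by field_simp
      _ ≤ 1 := by rw [div_le_one (by positivity)]; linarith
  have ht2 : ∀ k, κ * ((n k : ℝ) ^ 2)⁻¹ * (4 / (n k : ℝ) ^ ν) ≤ a (lvl k) * wt k ^ 2 := by
    intro k
    have hnk : (1 : ℝ) ≤ n k := by exact_mod_cast hn k
    have hN : 0 < (n k : ℝ) ^ ν := by positivity
    have hs := hscale k
    rw [div_le_iff₀ (by positivity)] at hs
    calc κ * ((n k : ℝ) ^ 2)⁻¹ * (4 / (n k : ℝ) ^ ν) ≤ amin / 4 * ((n k : ℝ) ^ 2)⁻¹ * (4 / (n k : ℝ) ^ ν) := by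
          have : 0 ≤ ((n k : ℝ) ^ 2)⁻¹ * (4 / (n k : ℝ) ^ ν) := by positivity
          nlinarith [min_le_right (cmin ^ 2 / (4 * ν)) (amin / 4)]
      _ = amin / ((n k : ℝ) ^ 2 * (n k : ℝ) ^ ν) := by field_simp
      _ ≤ a (lvl k) * wt k ^ 2 := by
          rw [div_le_iff₀ (by positivity)]
          calc amin ≤ a (lvl k) * wt k ^ 2 * (n k : ℝ) ^ ν * (n k : ℝ) ^ 2 := hs
            _ = a (lvl k) * wt k ^ 2 * ((n k : ℝ) ^ 2 * (n k : ℝ) ^ ν) := by ring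
  have hmain := multiscale_coercive_gauge src tgt c Rm blk W T a n lvl lab wt ε δ (fun k => κ * ((n k : ℝ) ^ 2)⁻¹) φ e g O
    hT hcmin hφinj hφblk hW hsrc htgt hcb hg hO hgauge hcmp ht0 ht1 ht2 hbond hcell f
  refine le_trans ?_ hmain
  rw [Finset.mul_sum]
  refine Finset.sum_le_sum fun k _ => ?_
  have hSnn : 0 ≤ ∑ v : Box ν (n k), ∑ i, f (φ k v, i) ^ 2 := sum_nonneg fun _ _ => sum_nonneg fun _ _ => sq_nonneg _
  calc (1 - θ) * κ * (((n k : ℝ) ^ 2)⁻¹ * ∑ v : Box ν (n k), ∑ i, f (φ k v, i) ^ 2)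
      = κ * ((n k : ℝ) ^ 2)⁻¹ * (1 - θ) * ∑ v : Box ν (n k), ∑ i, f (φ k v, i) ^ 2 := by ring
    _ ≤ κ * ((n k : ℝ) ^ 2)⁻¹ * (1 - 4 * ((ν : ℝ) * (n k) * ((n k : ℝ) - 1)) * ν * ε k ^ 2 - 4 * δ k ^ 2) *
          ∑ v : Box ν (n k), ∑ i, f (φ k v, i) ^ 2 := by
        refine mul_le_mul_of_nonneg_right ?_ hSnn
        exact mul_le_mul_of_nonneg_left (by linarith [hloss k]) (ht0 k)

end Assembly

end

end Summit.QuantumFields.BalabanUV.Beta.MultiscaleCoerciveGauge
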